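import Mathlib
import Summits.QuantumAdvantage.QuantumAdvantage.Theorems.LinnikCubicClassGroupsPureCubicClassNumberHardStubUnitsNormOne9
import Summits.QuantumAdvantage.QuantumAdvantage.Theorems.LinnikCubicClassGroupsPureCubicClassNumberHardStubInvariantIdealsPrincipal
import Summits.QuantumAdvantage.QuantumAdvantage.Theorems.LinnikCubicClassGroupsPureCubicClassNumberHardStubClassNumberNotDvd
import Literature.NumberTheory.NumberFields.PureCubicClassNumberModThreeProofs
import HarnessLib

/-!
# Chevalley's ambiguous ideals with THREE ramified primes, I: invariant ideals, unit cohomology, valuations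

Route `LinnikCubicClassGroups` (rank-0 hypothesis-type target `PureCubicClassNumberHard`,
stmt-QuantumAdvantage-11826); classical arithmetic of pure cubic fields (Honda 1971).  Generic
input for the cases of Honda's criterion in which `L = K(ζ₃)/F = ℚ(ζ₃)` has three ramified primes
(e.g. `K = ℚ(∛(pq))`, `p, q ≡ 2 (mod 3)`, `pq ≢ ±1 (mod 9)`: conductor `3pq`, `9pq`).  For a cyclic
cubic `L/F` with generator `σ`:

* `exists_eq_span_mul_pow₃` — with `𝓞_F` a PID and three totally ramified primes `Pᵢ³ = (tᵢ)`
  carrying all the ramification, every nonzero `σ`-invariant ideal is `(c)·P₁^a P₂^b P₃^d`,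
  `a, b, d < 3` (the tree's two-prime `exists_eq_span_mul_pow` with one more case);
* `index_le_three_of_cube`, `exists_equiv_of_ten_normOne_units` — for `F` totally complex with units
  `uⁱ v³`: `#Ĥ⁻¹(σ, 𝓞_Lˣ) = 3·#Ĥ⁰ ≤ 9` (unit Herbrand quotient `MinkowskiUnit.card_mul_h0_unitsE_eq`,
  Childress Prop. 5.10), so among more than nine norm-one units two are equivalent modulo a
  `σ`-coboundary;
* `intValuation_eq_exp_of_span_eq`, `intValuation_algebraMap_eq_exp_three_mul`, `norm_smul_eq` —
  valuation and norm bookkeeping (at a totally ramified `P` the `P`-adic valuation of an element of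
  `𝓞_F` is a cube, Mathlib `intValuation_liesOver`).

HONEST FRAMING (block-2b rule): kernel-checked classical algebraic number theory, NOT summit
progress; the crux `PureCubicClassNumberHard` is hypothesis-type.

## References
* T. Honda, *Pure cubic fields whose class numbers are multiples of three*, J. Number Theory 3
  (1971) 7–12. [Honda1971]
* N. Childress, *Class Field Theory* (2009), Ch. 4 §5 Prop. 5.10. [Childress2009]
-/

set_option linter.dupNamespace false

noncomputable section

open NumberField

open scoped Pointwise NumberField IntermediateField

namespace Summit.QuantumAdvantage.QuantumAdvantage.Theorems.LinnikCubicClassGroups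

open Literature.NumberTheory.GaloisRepresentations
open Literature.NumberTheory.GaloisRepresentations.MinkowskiUnit
open Literature.NumberTheory.NumberFields IsDedekindDomain

/-! ### Structure of invariant ideals with three ramified primes -/

/-- **Structure of invariant ideals (three ramified primes).**  With `𝓞_F` a PID, `𝔓ᵢ³ = (tᵢ)`
(`tᵢ ∈ 𝓞_F`, `i = 1, 2, 3`) and all ramification of the cyclic cubic `L/F` carried by
`𝔓₁, 𝔓₂, 𝔓₃`, a nonzero ideal of `𝓞_L` invariant under a generator `σ` of `Gal(L/F)` is
`(c) · 𝔓₁^a · 𝔓₂^b · 𝔓₃^d` with `c ∈ 𝓞_F` and `a, b, d < 3` (as the tree's two-prime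
`exists_eq_span_mul_pow`: peel off an invariant prime or a whole unramified orbit, Noetherian
induction). [folklore] -/
theorem exists_eq_span_mul_pow₃ {F L : Type*} [Field F] [Field L] [Algebra F L] [NumberField L]
    [NumberField F] [IsGalois F L] (σ : L ≃ₐ[F] L)
    (hσ : ∀ τ : L ≃ₐ[F] L, τ ∈ Subgroup.zpowers σ) (hPID : IsPrincipalIdealRing (𝓞 F))
    {P₁ P₂ P₃ : Ideal (𝓞 L)} (hP₁ : P₁.IsMaximal) (hP₂ : P₂.IsMaximal) (hP₃ : P₃.IsMaximal)
    {t₁ : 𝓞 F} (ht₁ : Ideal.span {algebraMap (𝓞 F) (𝓞 L) t₁} = P₁ ^ 3)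
    {t₂ : 𝓞 F} (ht₂ : Ideal.span {algebraMap (𝓞 F) (𝓞 L) t₂} = P₂ ^ 3)
    {t₃ : 𝓞 F} (ht₃ : Ideal.span {algebraMap (𝓞 F) (𝓞 L) t₃} = P₃ ^ 3)
    (hram : ∀ Q : Ideal (𝓞 L), Q.IsMaximal → Q.ramificationIdx (𝓞 F) ≠ 1 →
      Q = P₁ ∨ Q = P₂ ∨ Q = P₃)
    (I : Ideal (𝓞 L)) (hI : I ≠ ⊥) (hinv : σ • I = I) :
    ∃ (c : 𝓞 F) (a b d : ℕ), a < 3 ∧ b < 3 ∧ d < 3 ∧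
      I = Ideal.span {algebraMap (𝓞 F) (𝓞 L) c} * P₁ ^ a * P₂ ^ b * P₃ ^ d := by
  induction I using IsNoetherian.induction with
  | hgt I ih =>
    by_cases hI1 : I = ⊤
    · refine ⟨1, 0, 0, 0, by norm_num, by norm_num, by norm_num, ?_⟩
      rw [hI1, map_one, Ideal.span_singleton_one, pow_zero, pow_zero, pow_zero, mul_one, mul_one,
        mul_one]
    obtain ⟨Q, hQ, hIQ⟩ := Ideal.exists_le_maximal I hI1
    -- peeling one copy of `P` (invariant, `P³ = (t)`) off `I`
    have peel : ∀ {P : Ideal (𝓞 L)} (hP : P.IsMaximal) {t : 𝓞 F},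
        Ideal.span {algebraMap (𝓞 F) (𝓞 L) t} = P ^ 3 → I ≤ P →
        ∃ J : Ideal (𝓞 L), I = P * J ∧ ∃ (c : 𝓞 F) (a b d : ℕ), a < 3 ∧ b < 3 ∧ d < 3 ∧
          J = Ideal.span {algebraMap (𝓞 F) (𝓞 L) c} * P₁ ^ a * P₂ ^ b * P₃ ^ d := by
      intro P hP t ht hIP
      obtain ⟨J, hIJ, hlt, hJ0, hJinv⟩ :=
        exists_eq_mul_of_le σ hI hP.ne_top (smul_eq_of_pow_three_eq_span σ hP ht) hinv hIP
      exact ⟨J, hIJ, ih J hlt hJ0 hJinv⟩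
    by_cases h1 : Q = P₁
    · rw [h1] at hIQ
      obtain ⟨J, hIJ, c, a, b, d, ha, hb, hd, hJ⟩ := peel hP₁ ht₁ hIQ
      rcases Nat.lt_or_ge (a + 1) 3 with ha' | ha'
      · refine ⟨c, a + 1, b, d, ha', hb, hd, ?_⟩
        rw [hIJ, hJ]; ring
      · have ha2 : a = 2 := by omega
        refine ⟨c * t₁, 0, b, d, by norm_num, hb, hd, ?_⟩
        rw [hIJ, hJ, ha2, map_mul, ← Ideal.span_singleton_mul_span_singleton, ht₁]; ring
    by_cases h2 : Q = P₂
    · rw [h2] at hIQ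
      obtain ⟨J, hIJ, c, a, b, d, ha, hb, hd, hJ⟩ := peel hP₂ ht₂ hIQ
      rcases Nat.lt_or_ge (b + 1) 3 with hb' | hb'
      · refine ⟨c, a, b + 1, d, ha, hb', hd, ?_⟩
        rw [hIJ, hJ]; ring
      · have hb2 : b = 2 := by omega
        refine ⟨c * t₂, a, 0, d, ha, by norm_num, hd, ?_⟩
        rw [hIJ, hJ, hb2, map_mul, ← Ideal.span_singleton_mul_span_singleton, ht₂]; ring
    by_cases h3 : Q = P₃
    · rw [h3] at hIQ
      obtain ⟨J, hIJ, c, a, b, d, ha, hb, hd, hJ⟩ := peel hP₃ ht₃ hIQ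
      rcases Nat.lt_or_ge (d + 1) 3 with hd' | hd'
      · refine ⟨c, a, b, d + 1, ha, hb, hd', ?_⟩
        rw [hIJ, hJ]; ring
      · have hd2 : d = 2 := by omega
        refine ⟨c * t₃, a, b, 0, ha, hb, by norm_num, ?_⟩
        rw [hIJ, hJ, hd2, map_mul, ← Ideal.span_singleton_mul_span_singleton, ht₃]; ring
    -- `Q` is unramified: peel off the whole orbit `𝔮𝓞_L = (g)`
    have he : Q.ramificationIdx (𝓞 F) = 1 := by
      by_contra hne
      rcases hram Q hQ hne with h | h | h
      exacts [h1 h, h2 h, h3 h]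
    haveI := hPID
    obtain ⟨g, hg⟩ := (IsPrincipalIdealRing.principal (Q.under (𝓞 F))).principal
    have hM : (Q.under (𝓞 F)).map (algebraMap (𝓞 F) (𝓞 L)) =
        Ideal.span {algebraMap (𝓞 F) (𝓞 L) g} := by
      rw [hg, Ideal.submodule_span_eq, Ideal.map_span, Set.image_singleton]
    have hle : I ≤ Ideal.span {algebraMap (𝓞 F) (𝓞 L) g} :=
      hM ▸ le_map_under_of_smul_eq σ hσ hI hQ he hinv hIQ
    have hMtop : Ideal.span {algebraMap (𝓞 F) (𝓞 L) g} ≠ ⊤ := by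
      rw [← hM]
      exact fun h => hQ.ne_top (top_le_iff.mp (h ▸ Ideal.map_comap_le))
    obtain ⟨J, hIJ, hlt, hJ0, hJinv⟩ :=
      exists_eq_mul_of_le σ hI hMtop (smul_span_algebraMap σ g) hinv hle
    obtain ⟨c, a, b, d, ha, hb, hd, hJ⟩ := ih J hlt hJ0 hJinv
    refine ⟨g * c, a, b, d, ha, hb, hd, ?_⟩
    rw [hIJ, hJ, map_mul, ← Ideal.span_singleton_mul_span_singleton]
    ring

/-! ### At most nine norm-one units modulo coboundaries -/

/-- In a commutative group, a subgroup `N` containing all cubes, such that every element is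
`uⁱ v³`, has index at most `3` (the quotient is generated by the image of `u`, of order dividing
`3`; compare the tree's `index_eq_three_of_cube`). [folklore] -/
theorem index_le_three_of_cube {M : Type*} [CommGroup M] {N : Subgroup M} {u : M}
    (hcube : ∀ v : M, v ^ 3 ∈ N) (hgen : ∀ w : M, ∃ i : ℕ, ∃ v : M, w = u ^ i * v ^ 3) :
    N.index ≤ 3 := by
  have hq3 : ((u : M ⧸ N)) ^ 3 = 1 := by
    rw [← QuotientGroup.mk_pow, QuotientGroup.eq_one_iff]
    exact hcube u
  have hall : ∀ x : M ⧸ N, x ∈ Subgroup.zpowers (u : M ⧸ N) := by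
    intro x
    obtain ⟨w, rfl⟩ := QuotientGroup.mk_surjective x
    obtain ⟨i, v, rfl⟩ := hgen w
    rw [QuotientGroup.mk_mul, QuotientGroup.mk_pow, (QuotientGroup.eq_one_iff _).mpr (hcube v),
      mul_one]
    exact Subgroup.npow_mem_zpowers _ _
  rw [Subgroup.index_eq_card, ← orderOf_eq_card_of_forall_mem_zpowers hall]
  exact Nat.le_of_dvd (by norm_num) (orderOf_dvd_of_pow_eq_one hq3)


/-- **`#Ĥ⁻¹(σ, 𝓞_Lˣ) ≤ 9`.**  For `L/F` cyclic cubic with generator `σ`, `F` totally complex and a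
unit `u` of `F` with every unit of `F` of the form `uⁱ v³`: the index `#Ĥ⁰ = [𝓞_Fˣ : N(𝓞_Lˣ)]`
divides `3` (the norm subgroup contains the cubes), so by the unit Herbrand quotient
(`MinkowskiUnit.card_mul_h0_unitsE_eq`, `archFactor = 1`) `#Ĥ⁻¹ = 3·#Ĥ⁰ ≤ 9`; consequently among
any ten norm-one units of `L` two are equivalent modulo a `σ`-coboundary `σ(η)/η`. [folklore] -/
theorem exists_equiv_of_ten_normOne_units
    (F L : Type) [Field F] [NumberField F] [Field L] [NumberField L] [Algebra F L]
    [IsGalois F L] (σ : L ≃ₐ[F] L) (hσ : ∀ τ : L ≃ₐ[F] L, τ ∈ Subgroup.zpowers σ)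
    (hdeg : Module.finrank F L = 3) (hcx : ∀ v : NumberField.InfinitePlace F, v.IsComplex)
    (u : (𝓞 F)ˣ) (hgen : ∀ w : (𝓞 F)ˣ, ∃ i : ℕ, ∃ v : (𝓞 F)ˣ, w = u ^ i * v ^ 3)
    {ι : Type*} [Fintype ι] (hι : 9 < Fintype.card ι) (ε : ι → (𝓞 L)ˣ)
    (hεN : ∀ i, Algebra.norm F (((ε i : 𝓞 L) : L)) = 1) :
    ∃ i j, i ≠ j ∧ ∃ η : (𝓞 L)ˣ,
      (((ε i : 𝓞 L) : L)) * ((η : 𝓞 L) : L) = (((ε j : 𝓞 L) : L)) * σ ((η : 𝓞 L) : L) := by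
  classical
  have hcard : Fintype.card (L ≃ₐ[F] L) = 3 := by
    rw [Fintype.card_eq_nat_card, IsGalois.card_aut_eq_finrank, hdeg]
  have harch : ArchHerbrand.archFactor F L = 1 := by
    refine Finset.prod_eq_one fun v _ => ?_
    have hw : (ArchHerbrand.placeOver L v).IsUnramified F := by
      rw [NumberField.InfinitePlace.isUnramified_iff]
      refine Or.inr ?_
      rw [show (ArchHerbrand.placeOver L v).comap (algebraMap F L) = v from
        ArchHerbrand.isOver_placeOver v]
      exact hcx v
    exact NumberField.InfinitePlace.isUnramified_iff_card_stabilizer_eq_one.mp hw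
  -- `#Ĥ⁰ ∣ 3`
  have hcube : ∀ v : (𝓞 F)ˣ, v ^ 3 ∈ ((unitsE L).map (Herbrand.norm (L ≃ₐ[F] L))).comap
      (Units.map (algebraMap (𝓞 F) L : 𝓞 F →* L)) := by
    intro v
    rw [mem_comap_map_norm_iff]
    refine ⟨Units.map (algebraMap (𝓞 F) (𝓞 L) : 𝓞 F →* 𝓞 L) v, ?_⟩
    rw [Units.coe_map, MonoidHom.coe_coe, RingOfIntegers.coe_eq_algebraMap,
      ← IsScalarTower.algebraMap_apply, IsScalarTower.algebraMap_apply (𝓞 F) F L,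
      Algebra.norm_algebraMap, hdeg, Units.val_pow_eq_pow_val, RingOfIntegers.coe_eq_algebraMap,
      map_pow]
  have h0 : Herbrand.h0 σ (unitsE L) ⊥ ≤ 3 := by
    rw [h0_unitsE_eq_index hσ]
    exact index_le_three_of_cube hcube hgen
  have h1 : Herbrand.h1 σ (unitsE L) ⊥ ≤ 9 := by
    obtain ⟨hmain, -⟩ := MinkowskiUnit.card_mul_h0_unitsE_eq (F := F) (E := L) hσ
    rw [hcard, harch, one_mul] at hmain
    omega
  -- the quotient `Z¹/B¹` pulled back to `𝓞_Lˣ`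
  obtain ⟨Z, hZ⟩ : ∃ Z : Subgroup (𝓞 L)ˣ, Z = (Herbrand.z1 (L ≃ₐ[F] L) (unitsE L) ⊥).comap
      (Units.map (algebraMap (𝓞 L) L : 𝓞 L →* L)) := ⟨_, rfl⟩
  obtain ⟨B, hB⟩ : ∃ B : Subgroup (𝓞 L)ˣ, B = (Herbrand.b1 σ (unitsE L) ⊥).comap
      (Units.map (algebraMap (𝓞 L) L : 𝓞 L →* L)) := ⟨_, rfl⟩
  have hidx : Nat.card (Z ⧸ B.subgroupOf Z) = Herbrand.h1 σ (unitsE L) ⊥ := by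
    rw [Herbrand.h1_def, ← Subgroup.index_eq_card]
    change B.relIndex Z = _
    rw [hB, Subgroup.relIndex_comap, hZ, Subgroup.map_comap_eq, show (Units.map
        (algebraMap (𝓞 L) L : 𝓞 L →* L)).range = unitsE L from rfl, inf_eq_right.mpr Herbrand.z1_le]
  have hfin : Nat.card (Z ⧸ B.subgroupOf Z) ≠ 0 := by
    obtain ⟨-, hne⟩ := MinkowskiUnit.card_mul_h0_unitsE_eq (F := F) (E := L) hσ
    rwa [hidx]
  haveI : Finite (Z ⧸ B.subgroupOf Z) := Nat.finite_of_card_ne_zero hfin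
  haveI : Fintype (Z ⧸ B.subgroupOf Z) := Fintype.ofFinite _
  -- the norm-one units live in `Z`; their classes cannot be pairwise distinct
  have hmemZ : ∀ i, ε i ∈ Z := by
    intro i
    rw [hZ, Subgroup.mem_comap, Herbrand.mem_z1_bot]
    exact ⟨⟨ε i, rfl⟩, (herbrandNorm_eq_one_iff _).mpr (hεN i)⟩
  let cls : ι → Z ⧸ B.subgroupOf Z := fun i => QuotientGroup.mk ⟨ε i, hmemZ i⟩
  have hnotinj : ¬ Function.Injective cls := by
    intro hinj
    have := Fintype.card_le_of_injective cls hinj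
    rw [Fintype.card_eq_nat_card (α := Z ⧸ B.subgroupOf Z), hidx] at this
    omega
  obtain ⟨i, j, hcls, hij⟩ : ∃ i j, cls i = cls j ∧ i ≠ j := by
    by_contra h
    push Not at h
    exact hnotinj fun i j hc => h i j hc
  refine ⟨j, i, Ne.symm hij, ?_⟩
  -- unpack `cls i = cls j`: `(ε i)⁻¹ ε j ∈ B`, i.e. `ε i⁻¹ ε j = σ η' / η'`
  have hB' : (⟨ε i, hmemZ i⟩ : Z)⁻¹ * ⟨ε j, hmemZ j⟩ ∈ B.subgroupOf Z := by
    rw [← QuotientGroup.eq]; exact hcls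
  rw [Subgroup.mem_subgroupOf, Subgroup.coe_mul, Subgroup.coe_inv] at hB'
  simp only at hB'
  rw [hB, Subgroup.mem_comap, map_mul, map_inv, Herbrand.b1_bot] at hB'
  obtain ⟨w, ⟨η, rfl⟩, hw⟩ := hB'
  refine ⟨η, ?_⟩
  rw [Herbrand.twist_apply] at hw
  -- `σ η / η = (ε i)⁻¹ ε j` in `Lˣ`
  have hval := congrArg (fun z : Lˣ => (z : L)) hw
  simp only [Units.val_div_eq_div_val, val_smul, val_unitsMap, Units.val_mul, Units.val_inv_eq_inv_val] at hval
  have hεi0 : (((ε i : 𝓞 L) : L)) ≠ 0 :=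
    RingOfIntegers.coe_ne_zero_iff.mpr (Units.ne_zero _)
  have hη0 : (((η : 𝓞 L) : L)) ≠ 0 := RingOfIntegers.coe_ne_zero_iff.mpr (Units.ne_zero _)
  rw [div_eq_iff hη0] at hval
  -- `σ η = (ε i)⁻¹ ε j η`, so `ε j η = ε i σ η`
  have : (((ε i : 𝓞 L) : L)) * σ (((η : 𝓞 L) : L)) =
      (((ε j : 𝓞 L) : L)) * (((η : 𝓞 L) : L)) := by
    rw [hval]; field_simp
  exact this.symm


/-! ### Valuations at a totally ramified prime -/

/-- The valuation at `P` of a generator of `P^a · J`, `P ∤ J`, is `exp(−a)`. [folklore] -/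
theorem intValuation_eq_exp_of_span_eq {L : Type*} [Field L] [NumberField L]
    (w : HeightOneSpectrum (𝓞 L)) {y : 𝓞 L} (hy : y ≠ 0) {a : ℕ} {J : Ideal (𝓞 L)}
    (hspan : Ideal.span {y} = w.asIdeal ^ a * J) (hJ : ¬ w.asIdeal ∣ J) :
    w.intValuation y = WithZero.exp (-(a : ℤ)) := by
  classical
  have hle : w.intValuation y ≤ WithZero.exp (-(a : ℤ)) := by
    rw [HeightOneSpectrum.intValuation_le_pow_iff_dvd, hspan]
    exact dvd_mul_right _ _
  have hnot : ¬ w.intValuation y ≤ WithZero.exp (-((a + 1 : ℕ) : ℤ)) := by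
    rw [HeightOneSpectrum.intValuation_le_pow_iff_dvd, hspan, pow_succ]
    intro h
    have hJ0 : w.asIdeal ^ a ≠ 0 := pow_ne_zero _ w.ne_bot
    exact hJ ((mul_dvd_mul_iff_left hJ0).mp h)
  rw [w.intValuation_eq_exp_neg_multiplicity hy] at hle hnot ⊢
  rw [WithZero.exp_le_exp] at hle hnot
  rw [WithZero.exp_inj]
  push_cast at hnot
  omega

/-- Over a prime `P` of `L` with `e(P | P ∩ 𝓞_F) = 3`, the `P`-adic valuation of a nonzero element
of `𝓞_F` is a cube: `exp(−3k)`. [folklore] -/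
theorem intValuation_algebraMap_eq_exp_three_mul {F L : Type*} [Field F] [NumberField F] [Field L]
    [NumberField L] [Algebra F L] (w : HeightOneSpectrum (𝓞 L))
    (he : w.asIdeal.ramificationIdx (𝓞 F) = 3) {f : 𝓞 F} (hf : f ≠ 0) :
    ∃ k : ℕ, w.intValuation (algebraMap (𝓞 F) (𝓞 L) f) = WithZero.exp (-(3 * (k : ℤ))) := by
  classical
  haveI := w.isMaximal
  haveI : (w.asIdeal.under (𝓞 F)).IsMaximal := Ideal.IsMaximal.under _ _
  have hv0 : w.asIdeal.under (𝓞 F) ≠ ⊥ := Ideal.IsMaximal.ne_bot_of_isIntegral_int _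
  let v : HeightOneSpectrum (𝓞 F) :=
    ⟨w.asIdeal.under (𝓞 F), Ideal.IsMaximal.isPrime inferInstance, hv0⟩
  haveI : w.asIdeal.LiesOver v.asIdeal := ⟨rfl⟩
  have h := IsDedekindDomain.HeightOneSpectrum.intValuation_liesOver v w f
  have he' : v.asIdeal.ramificationIdx' w.asIdeal = 3 := by
    rw [Ideal.ramificationIdx'_eq_ramificationIdx v.asIdeal w.asIdeal hv0]
    exact he
  rw [he', v.intValuation_eq_exp_neg_multiplicity hf, ← WithZero.exp_nsmul] at h
  refine ⟨multiplicity v.asIdeal (Ideal.span {f}), ?_⟩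
  rw [← h]
  congr 1
  ring

/-- The relative norm is invariant under the Galois group: `N_{L/F}(g x) = N_{L/F}(x)`
(`N = ∏_τ τ`, reindex by `τ ↦ τ g`). [folklore] -/
theorem norm_smul_eq {F L : Type*} [Field F] [Field L] [Algebra F L] [FiniteDimensional F L]
    [IsGalois F L] (g : L ≃ₐ[F] L) (x : L) : Algebra.norm F (g x) = Algebra.norm F x := by
  apply (algebraMap F L).injective
  rw [Algebra.norm_eq_prod_automorphisms, Algebra.norm_eq_prod_automorphisms]
  exact Fintype.prod_equiv (Equiv.mulRight g) _ _ fun τ => by simp [AlgEquiv.mul_apply]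


end Summit.QuantumAdvantage.QuantumAdvantage.Theorems.LinnikCubicClassGroups

end
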